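import Summits.AtomisticToContinuum.FouriersLaw.Theorems.BondHeatUncertaintyBoundedResponseTailSignB

/-!
# `BondHeatUncertainty.BoundedResponse` (11071) — NODE g97 «TailSign», final part (continuation of `…TailSignA`, `…TailSignB`)

§5 the exact bookkeeping `E_N = X_N(t) + S_N(t) − R_N(t)` and **DOOR v9** `TransmissionWindowBound → ReturnTailFloor → WindowSurvivalPoint →
BoundedResponse` with converse (`TransmissionWindowBound ↔ BoundedResponse` modulo the diffusive-window floors), door v8 on the fixed-`N` rungs;
§6 the readings of record compared; §7 the legs (D_S), (U), (F₁) on the fixed-`N` tail rungs and door v7 on its true hypotheses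
`LeakPoint → ReturnTailSign → SurvivalSign → BoundedResponse`.  Setting, grading, the imported refutation of 13198 at `N = 1`, tags and the
honest score: see the module docstring of part A.  0 sorry, no new axioms.
-/

noncomputable section

open MeasureTheory ProbabilityTheory Filter Topology Set Function
open scoped NNReal ENNReal
open Literature.MathematicalPhysics.KineticTheory.HeatConduction
open Literature.MathematicalPhysics.KineticTheory OscillatorChain
open Summit.AtomisticToContinuum.FouriersLaw.Theorems.SubdiffusiveBondHeat
open Summit.AtomisticToContinuum.FouriersLaw.Theorems.OddSectorIrreversibility
open Summit.AtomisticToContinuum.FouriersLaw.Theorems.BoundedResponse.TransientBand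

namespace Summit.AtomisticToContinuum.FouriersLaw.Theorems.BoundedResponse.ParityFloor

open Summit.AtomisticToContinuum.FouriersLaw.Theses.BondHeatUncertainty (BoundedResponse)
open Summit.AtomisticToContinuum.FouriersLaw.Theses.GriffithsLimitExchange (BoundaryDEP FiniteHorizonTransmission)
open Summit.AtomisticToContinuum.FouriersLaw.Theorems.SubdiffusiveBondHeat.EscapeGrading
  (escapeDeficit OhmicFloor ohmicFloor_iff_boundedResponse)

section TailSign

variable {ω₂ lam β γ T : ℝ} {N : ℕ}

/-! ## §5 The exact bookkeeping `E_N = X_N(t) + S_N(t) − R_N(t)`, DOOR v9 on the floors, door v8 on the fixed-`N` rungs -/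

/-- **Upper sandwich on the return tail only**: `∫_{(t,∞)} K_N ≥ 0 ⟹ E_N ≤ X_N(t) + S_N(t)` (`N ≥ 2`, `t ≥ 0`):
`E_N = X_N(t) + (γ/T²)∫_{(t,∞)}K̃_N = X_N(t) + S_N(t) − (γ/T²)∫_{(t,∞)}K_N`. [new] -/
theorem escapeDeficit_le_transmission_add_survival_of_returnTail (hω : 0 < ω₂) (hl : 0 < lam) (hβ : 0 < β)
    (hγ : 0 < γ) (hN : 2 ≤ N) (hT : 0 < T) {t : ℝ} (ht : 0 ≤ t)
    (hR : 0 ≤ ∫ u in Ioi t, escapeKernel ω₂ lam β γ T N u) :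
    escapeDeficit ω₂ lam β γ T N ≤
      γ / T ^ 2 * (∫ u in Ioc 0 t, crossKernel ω₂ lam β γ T N u) + survival ω₂ lam β γ T N t := by
  rw [escapeDeficit_eq_integral_crossKernel hω hl hβ hγ hN hT, integral_crossKernel_split hω hl hβ hγ hT N ht,
    survival_eq_tails hω hl hβ hγ hT N ht, mul_add, mul_add]
  linarith [mul_nonneg (by positivity : 0 ≤ γ / T ^ 2) hR]

/-- **The exact bookkeeping**: `E_N = X_N(t) + S_N(t) − (γ/T²)∫_{(t,∞)} K_N` for `t ≥ 0` (`N ≥ 2`) — the return tail enters with a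
minus sign, which is why a return-tail sign is unavoidable in any survival-budget bound on `E_N`. [new] -/
theorem escapeDeficit_eq_transmission_add_survival_sub_returnTail (hω : 0 < ω₂) (hl : 0 < lam) (hβ : 0 < β)
    (hγ : 0 < γ) (hN : 2 ≤ N) (hT : 0 < T) {t : ℝ} (ht : 0 ≤ t) :
    escapeDeficit ω₂ lam β γ T N =
      γ / T ^ 2 * (∫ u in Ioc 0 t, crossKernel ω₂ lam β γ T N u) + survival ω₂ lam β γ T N t -
        γ / T ^ 2 * ∫ u in Ioi t, escapeKernel ω₂ lam β γ T N u := by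
  rw [escapeDeficit_eq_integral_crossKernel hω hl hβ hγ hN hT, integral_crossKernel_split hω hl hβ hγ hT N ht,
    survival_eq_tails hω hl hβ hγ hT N ht]
  ring

/-- **Lower sandwich on the cross tail only**: `∫_{(t,∞)} K̃_N ≥ 0 ⟹ X_N(t) ≤ E_N` (`N ≥ 2`, `t ≥ 0`). [new] -/
theorem transmission_le_escapeDeficit_of_crossTail (hω : 0 < ω₂) (hl : 0 < lam) (hβ : 0 < β) (hγ : 0 < γ)
    (hN : 2 ≤ N) (hT : 0 < T) {t : ℝ} (ht : 0 ≤ t) (hX : 0 ≤ ∫ u in Ioi t, crossKernel ω₂ lam β γ T N u) :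
    γ / T ^ 2 * (∫ u in Ioc 0 t, crossKernel ω₂ lam β γ T N u) ≤ escapeDeficit ω₂ lam β γ T N := by
  rw [escapeDeficit_eq_integral_crossKernel hω hl hβ hγ hN hT, integral_crossKernel_split hω hl hβ hγ hT N ht, mul_add]
  linarith [mul_nonneg (by positivity : 0 ≤ γ / T ^ 2) hX]

/-- **Reading of (RT)** at fixed `N`, `t ≥ 0`: `∫_{(t,∞)} K_N ≥ 0 ↔ θ_N(t) ≤ 1 − E_N = θ_N(∞)` — the near step response never
overshoots its final value (the MD-facing form of the return-tail sign). [new] -/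
theorem returnTail_nonneg_iff_stepResponse_le (hω : 0 < ω₂) (hl : 0 < lam) (hβ : 0 < β) (hγ : 0 < γ) (hT : 0 < T) (N : ℕ)
    {t : ℝ} (ht : 0 ≤ t) :
    0 ≤ ∫ u in Ioi t, escapeKernel ω₂ lam β γ T N u ↔
      stepResponse ω₂ lam β γ T N t ≤ 1 - escapeDeficit ω₂ lam β γ T N := by
  rw [escapeDeficit_eq, sub_sub_cancel, stepResponse, intervalIntegral.integral_of_le ht,
    integral_escapeKernel_split hω hl hβ hγ hT N ht, mul_add]
  have hc : 0 < γ / T ^ 2 := by positivity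
  constructor
  · intro h
    linarith [mul_nonneg hc.le h]
  · intro h
    exact (mul_nonneg_iff_of_pos_left hc).1 (by linarith)

/-- **Reading of (CT)** at fixed `N ≥ 2`, `t ≥ 0`: `∫_{(t,∞)} K̃_N ≥ 0 ↔ X_N(t) ≤ E_N` — the transmission collected by time `t`
never exceeds the total. [new] -/
theorem crossTail_nonneg_iff_transmission_le (hω : 0 < ω₂) (hl : 0 < lam) (hβ : 0 < β) (hγ : 0 < γ) (hN : 2 ≤ N)
    (hT : 0 < T) {t : ℝ} (ht : 0 ≤ t) :
    0 ≤ ∫ u in Ioi t, crossKernel ω₂ lam β γ T N u ↔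
      γ / T ^ 2 * (∫ u in Ioc 0 t, crossKernel ω₂ lam β γ T N u) ≤ escapeDeficit ω₂ lam β γ T N := by
  rw [escapeDeficit_eq_integral_crossKernel hω hl hβ hγ hN hT, integral_crossKernel_split hω hl hβ hγ hT N ht, mul_add]
  have hc : 0 < γ / T ^ 2 := by positivity
  constructor
  · intro h
    linarith [mul_nonneg hc.le h]
  · intro h
    exact (mul_nonneg_iff_of_pos_left hc).1 (by linarith)

/-- **DOOR v9 (diffusive-window floors): `TransmissionWindowBound → ReturnTailFloor → WindowSurvivalPoint → BoundedResponse`.**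
With `(A, C₀)` from (TW), `C_R` from (RT∞) at `A`, `C_S` and the time `t ∈ [A·N², 2A·N²]` from (WSP) at `A`: for all large `N`,
`N·E_N = N·X_N(t) + N·S_N(t) − N·R_N(t) ≤ C₀ + C_S + C_R`.  No sign of any kernel, tail or survival is used — only `O(1/N)` floors /
ceilings at ONE diffusive time. [new] -/
theorem boundedResponse_of_transmissionWindowBound_floors :
    TransmissionWindowBound → ReturnTailFloor → WindowSurvivalPoint → BoundedResponse := by
  intro hTW hR hS
  refine ohmicFloor_iff_boundedResponse.mp fun ω₂ lam β γ hω hl hβ hγ T hT => ?_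
  obtain ⟨A, C₀, hA, hev⟩ := hTW ω₂ lam β γ hω hl hβ hγ T hT
  obtain ⟨C_R, hevR⟩ := hR ω₂ lam β γ hω hl hβ hγ T hT A hA
  obtain ⟨C_S, hevS⟩ := hS ω₂ lam β γ hω hl hβ hγ T hT A hA
  obtain ⟨N₁, hN₁⟩ := eventually_atTop.1 ((hev.and (hevR.and hevS)).and (eventually_ge_atTop 2))
  refine ⟨C₀ + C_S + C_R, N₁, fun N hN => ?_⟩
  obtain ⟨⟨hX, hRN, ⟨t, ht, hSt⟩⟩, hN2⟩ := hN₁ N hN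
  have hNpos : (0 : ℝ) < N := by exact_mod_cast (show 0 < N by omega)
  have ht0 : 0 ≤ t := le_trans (by positivity) ht.1
  have hXt := hX t ht
  have hRt := hRN t ht
  have hid := escapeDeficit_eq_transmission_add_survival_sub_returnTail hω hl hβ hγ hN2 hT ht0
  rw [le_div_iff₀ hNpos]
  have key : escapeDeficit ω₂ lam β γ T N * N =
      (N : ℝ) * (γ / T ^ 2 * ∫ u in Ioc 0 t, crossKernel ω₂ lam β γ T N u) + (N : ℝ) * survival ω₂ lam β γ T N t -
        (N : ℝ) * (γ / T ^ 2 * ∫ u in Ioi t, escapeKernel ω₂ lam β γ T N u) := by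
    rw [hid]; ring
  linarith

/-- **Converse on the cross floor: `BoundedResponse → CrossTailFloor → TransmissionWindowBound`**
(`X_N(t) = E_N − (γ/T²)∫_{(t,∞)}K̃_N ≤ (C₁ + C)/N` on `[N², 2N²]`; window constant `A = 1`). [new] -/
theorem transmissionWindowBound_of_boundedResponse_crossTailFloor :
    BoundedResponse → CrossTailFloor → TransmissionWindowBound := by
  intro hB hX ω₂ lam β γ hω hl hβ hγ T hT
  obtain ⟨C₁, N₀, hE⟩ := ohmicFloor_iff_boundedResponse.mpr hB ω₂ lam β γ hω hl hβ hγ T hT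
  obtain ⟨C, hev⟩ := hX ω₂ lam β γ hω hl hβ hγ T hT 1 one_pos
  refine ⟨1, C₁ + C, one_pos, ?_⟩
  filter_upwards [hev, eventually_ge_atTop (max N₀ 2)] with N hXN hN t ht
  have hN2 : 2 ≤ N := le_of_max_le_right hN
  have hNpos : (0 : ℝ) < N := by exact_mod_cast (show 0 < N by omega)
  have ht0 : 0 ≤ t := le_trans (by positivity) ht.1
  have hXt := hXN t ht
  have hEN : escapeDeficit ω₂ lam β γ T N * N ≤ C₁ := (le_div_iff₀ hNpos).1 (hE N (le_of_max_le_left hN))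
  have hid : γ / T ^ 2 * (∫ u in Ioc 0 t, crossKernel ω₂ lam β γ T N u) =
      escapeDeficit ω₂ lam β γ T N - γ / T ^ 2 * ∫ u in Ioi t, crossKernel ω₂ lam β γ T N u := by
    rw [escapeDeficit_eq_integral_crossKernel hω hl hβ hγ hN2 hT, integral_crossKernel_split hω hl hβ hγ hT N ht0]
    ring
  calc (N : ℝ) * (γ / T ^ 2 * ∫ u in Ioc 0 t, crossKernel ω₂ lam β γ T N u)
      = escapeDeficit ω₂ lam β γ T N * N - (N : ℝ) * (γ / T ^ 2 * ∫ u in Ioi t, crossKernel ω₂ lam β γ T N u) := by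
        rw [hid]; ring
    _ ≤ C₁ + C := by linarith

/-- **`TransmissionWindowBound ↔ BoundedResponse` modulo the three diffusive-window floors** — the reading of 11071 of this
node; the floors are the weakest sign-type side hypotheses a survival-budget door can consume. [new] -/
theorem transmissionWindowBound_iff_boundedResponse_of_floors (hR : ReturnTailFloor) (hX : CrossTailFloor)
    (hS : WindowSurvivalPoint) : TransmissionWindowBound ↔ BoundedResponse :=
  ⟨fun hTW => boundedResponse_of_transmissionWindowBound_floors hTW hR hS,
    fun hB => transmissionWindowBound_of_boundedResponse_crossTailFloor hB hX⟩

/-- **DOOR v8 (fixed-`N` tail rungs): `TransmissionWindowBound → ReturnTailSign → SurvivalSign → BoundedResponse`** — a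
corollary of door v9 (`RT → RT∞`, `SS → WSP`). [new] -/
theorem boundedResponse_of_transmissionWindowBound_returnTail_survivalSign :
    TransmissionWindowBound → ReturnTailSign → SurvivalSign → BoundedResponse := fun hTW hR hS =>
  boundedResponse_of_transmissionWindowBound_floors hTW (returnTailFloor_of_returnTailSign hR)
    (windowSurvivalPoint_of_survivalSign hS)

/-- `BoundedResponse → CrossTailSign → TransmissionWindowBound`. [formal bookkeeping] -/
theorem transmissionWindowBound_of_boundedResponse_crossTail :
    BoundedResponse → CrossTailSign → TransmissionWindowBound := fun hB hX =>
  transmissionWindowBound_of_boundedResponse_crossTailFloor hB (crossTailFloor_of_crossTailSign hX)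

/-- **`TransmissionWindowBound ↔ BoundedResponse` modulo `TailDEP`** (the `N ≥ 2` tail form of the sign crux). [new] -/
theorem transmissionWindowBound_iff_boundedResponse_of_tailDEP (h : TailDEP) :
    TransmissionWindowBound ↔ BoundedResponse :=
  transmissionWindowBound_iff_boundedResponse_of_floors (returnTailFloor_of_returnTailSign h.1)
    (crossTailFloor_of_crossTailSign h.2) (windowSurvivalPoint_of_survivalSign (survivalSign_of_tailDEP h))

/-- A fortiori: `TransmissionWindowBound → BoundaryDEP → BoundedResponse` (door v7's sign leg in window-leak form; kept for the
record — the hypothesis 13198 is numerically refuted at `N = 1`). [formal bookkeeping] -/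
theorem boundedResponse_of_transmissionWindowBound_boundaryDEP :
    TransmissionWindowBound → BoundaryDEP → BoundedResponse := fun hTW hDEP =>
  (transmissionWindowBound_iff_boundedResponse_of_tailDEP (tailDEP_of_boundaryDEP hDEP)).mp hTW

/-! ## §6 The readings of record compared -/

/-- `TransmissionWindowBound → FiniteHorizonBound` (take the left end `t = A·N²` of the window). [formal bookkeeping] -/
theorem finiteHorizonBound_of_transmissionWindowBound : TransmissionWindowBound → FiniteHorizonBound := by
  intro hTW ω₂ lam β γ hω hl hβ hγ T hT
  obtain ⟨A, C, hA, hev⟩ := hTW ω₂ lam β γ hω hl hβ hγ T hT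
  refine ⟨A, C, hA, hev.mono fun N hN => hN _ ⟨le_rfl, ?_⟩⟩
  have : (0 : ℝ) ≤ A * (N : ℝ) ^ 2 := by positivity
  linarith

/-- `FiniteHorizonBound → BoundaryDEP → TransmissionWindowBound` (under the pointwise far sign `X_N` is non-decreasing; window
constant `A/2`). [formal bookkeeping] -/
theorem transmissionWindowBound_of_finiteHorizonBound_boundaryDEP :
    FiniteHorizonBound → BoundaryDEP → TransmissionWindowBound := by
  intro hFH hDEP ω₂ lam β γ hω hl hβ hγ T hT
  obtain ⟨A, C, hA, hev⟩ := hFH ω₂ lam β γ hω hl hβ hγ T hT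
  refine ⟨A / 2, C, by positivity, hev.mono fun N hN t ht => ?_⟩
  obtain ⟨-, hKt⟩ := kernels_nonneg_of_boundaryDEP hDEP hω hl hβ hγ hT N
  have h2 : 2 * (A / 2 * (N : ℝ) ^ 2) = A * (N : ℝ) ^ 2 := by ring
  rw [h2] at ht
  have hmono : ∫ u in Ioc 0 t, crossKernel ω₂ lam β γ T N u ≤ ∫ u in Ioc 0 (A * (N : ℝ) ^ 2), crossKernel ω₂ lam β γ T N u :=
    setIntegral_mono_set ((integrableOn_crossKernel hω hl hβ hγ hT N).mono_set Ioc_subset_Ioi_self)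
      ((ae_restrict_iff' measurableSet_Ioc).2 (Eventually.of_forall fun u hu => hKt u (le_of_lt hu.1)))
      (Ioc_subset_Ioc_right ht.2).eventuallyLE
  have hc : (0 : ℝ) ≤ (N : ℝ) * (γ / T ^ 2) := by positivity
  calc (N : ℝ) * (γ / T ^ 2 * ∫ u in Ioc 0 t, crossKernel ω₂ lam β γ T N u)
      = (N : ℝ) * (γ / T ^ 2) * ∫ u in Ioc 0 t, crossKernel ω₂ lam β γ T N u := by ring
    _ ≤ (N : ℝ) * (γ / T ^ 2) * ∫ u in Ioc 0 (A * (N : ℝ) ^ 2), crossKernel ω₂ lam β γ T N u :=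
        mul_le_mul_of_nonneg_left hmono hc
    _ = (N : ℝ) * (γ / T ^ 2 * ∫ u in Ioc 0 (A * (N : ℝ) ^ 2), crossKernel ω₂ lam β γ T N u) := by ring
    _ ≤ C := hN

/-- Under 13198 (numerically refuted at `N = 1`; kept for the record) the window and point readings coincide. [formal bookkeeping] -/
theorem transmissionWindowBound_iff_finiteHorizonBound_of_boundaryDEP (hDEP : BoundaryDEP) :
    TransmissionWindowBound ↔ FiniteHorizonBound :=
  ⟨finiteHorizonBound_of_transmissionWindowBound, fun h => transmissionWindowBound_of_finiteHorizonBound_boundaryDEP h hDEP⟩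

/-! ## §7 Door v6/v7's legs on the fixed-`N` tail rungs: (D_S), (U), (F₁), and DOOR v7 on its true hypotheses -/

/-- `S^{stor}_N(t) ≥ 0` for `t ≥ 0` under the survival sign (`N ≥ 2`). [formal bookkeeping] -/
theorem storageResponse_nonneg_of_survival_nonneg (hω : 0 < ω₂) (hl : 0 < lam) (hβ : 0 < β) (hγ : 0 < γ) (hN : 2 ≤ N)
    (hT : 0 < T) (hS : ∀ s : ℝ, 0 ≤ s → 0 ≤ survival ω₂ lam β γ T N s) {t : ℝ} (ht : 0 ≤ t) :
    0 ≤ storageResponse ω₂ lam β γ T N t := by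
  rw [storageResponse_eq_integral_survival hω hl hβ hγ hN hT ht]
  exact intervalIntegral.integral_nonneg ht fun s hs => hS s hs.1

/-- **(D_S) ⟸ `SurvivalSign`: `SurvivalSign → StorageBound`** with `C = |C_V|/(2γT²)`, `N₀ = 2`, uniformly in `t ≥ 0`. [new] -/
theorem storageBound_of_survivalSign : SurvivalSign → StorageBound := by
  intro hS ω₂ lam β γ hω hl hβ hγ T hT
  obtain ⟨C, hC⟩ := energyFluctuationExtensive_holds ω₂ lam β γ hω hl hβ hγ T hT
  refine ⟨|C| / (2 * γ * T ^ 2), 2, fun N hN t ht => ?_⟩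
  have hSN : ∀ s : ℝ, 0 ≤ s → 0 ≤ survival ω₂ lam β γ T N s := fun s hs => hS ω₂ lam β γ hω hl hβ hγ T hT N s hN hs
  have hV : energyVariance ω₂ lam β γ T N ≤ |C| * N := (hC N).trans (by gcongr; exact le_abs_self C)
  calc storageResponse ω₂ lam β γ T N t ≤ energyVariance ω₂ lam β γ T N / (2 * γ * T ^ 2) :=
        storageResponse_le_variance_of_survival_nonneg hω hl hβ hγ hN hT hSN ht
    _ ≤ |C| * N / (2 * γ * T ^ 2) := by gcongr
    _ = |C| / (2 * γ * T ^ 2) * N := by ring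

/-- `Ov_N(t) ≤ S^{stor}_N(t)` for `t ≥ 0` on the CROSS TAIL sign alone (`N ≥ 2`): `1 − θ_N(s) − E_N ≤ 1 − θ_N(s) − φ_N(s) = S_N(s)`
because `φ_N(s) ≤ E_N`. [new] -/
theorem escapeTransient_le_storageResponse_of_crossTail (hω : 0 < ω₂) (hl : 0 < lam) (hβ : 0 < β) (hγ : 0 < γ)
    (hN : 2 ≤ N) (hT : 0 < T) (hX : ∀ s : ℝ, 0 ≤ s → 0 ≤ ∫ u in Ioi s, crossKernel ω₂ lam β γ T N u)
    {t : ℝ} (ht : 0 ≤ t) : escapeTransient ω₂ lam β γ T N t ≤ storageResponse ω₂ lam β γ T N t := by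
  have h01 : IntervalIntegrable (survival ω₂ lam β γ T N) volume 0 t := intervalIntegrable_survival hω hl hβ hγ hN hT le_rfl ht
  have hθi : IntervalIntegrable (fun s => (1 - stepResponse ω₂ lam β γ T N s) - escapeDeficit ω₂ lam β γ T N)
      volume 0 t :=
    (intervalIntegrable_const.sub ((continuous_stepResponse hω hl hβ hγ hT N).intervalIntegrable 0 t)).sub
      intervalIntegrable_const
  rw [← integral_transient_eq hω hl hβ hγ hT N ht, storageResponse_eq_integral_survival hω hl hβ hγ hN hT ht]
  refine intervalIntegral.integral_mono_on ht hθi h01 fun s hs => ?_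
  rw [survival_eq hω hl hβ hγ hN hT hs.1, intervalIntegral.integral_of_le hs.1]
  linarith [transmission_le_escapeDeficit_of_crossTail hω hl hβ hγ hN hT hs.1 (hX s hs.1)]

/-- **(U) ⟸ `CrossTailSign ∧ SurvivalSign`** (`Ov_N(N²) ≤ S^{stor}_N(N²) ≤ |C_V|N/(2γT²)`). [new] -/
theorem transientCeilingPoint_of_crossTail_survivalSign : CrossTailSign → SurvivalSign → TransientCeilingPoint := by
  intro hX hS ω₂ lam β γ hω hl hβ hγ T hT
  obtain ⟨C, N₀, hSB⟩ := storageBound_of_survivalSign hS ω₂ lam β γ hω hl hβ hγ T hT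
  refine ⟨C, 1, one_pos, max N₀ 2, fun N hN => ?_⟩
  have hN2 : 2 ≤ N := le_of_max_le_right hN
  have ht : (0 : ℝ) ≤ 1 * (N : ℝ) ^ 2 := by positivity
  exact (escapeTransient_le_storageResponse_of_crossTail hω hl hβ hγ hN2 hT
    (fun s hs => hX ω₂ lam β γ hω hl hβ hγ T hT N s hN2 hs) ht).trans (hSB N (le_of_max_le_left hN) _ ht)

/-- **The transient integrand IS the return tail**: `(1 − θ_N(s)) − E_N = (γ/T²)∫_{(s,∞)} K_N` for `s ≥ 0` (any `N`). [folklore] -/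
theorem oneSub_stepResponse_sub_escapeDeficit_eq_returnTail (hω : 0 < ω₂) (hl : 0 < lam) (hβ : 0 < β) (hγ : 0 < γ)
    (hT : 0 < T) (N : ℕ) {s : ℝ} (hs : 0 ≤ s) :
    (1 - stepResponse ω₂ lam β γ T N s) - escapeDeficit ω₂ lam β γ T N =
      γ / T ^ 2 * ∫ u in Ioi s, escapeKernel ω₂ lam β γ T N u := by
  rw [escapeDeficit_eq, stepResponse, intervalIntegral.integral_of_le hs, integral_escapeKernel_split hω hl hβ hγ hT N hs]
  ring

/-- **(F_g) ⟸ `ReturnTailSign`** at every grade, with `N₀ = 2` and constant `0`: `Ov_N(cN²) = ∫₀^{cN²} R_N(s) ds ≥ 0` — (F₁) is the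
`O(N)`-tolerant CESÀRO form of the return-tail sign (cf. the tree's `transientFloor_of_kernelTail_nonneg`, g93, whose inline hypothesis
is (RT) quantified from `N = 1`, the instance the ledger witness refutes). [formal bookkeeping] -/
theorem transientFloor_of_returnTailSign (g : ℝ) : ReturnTailSign → TransientFloor g := by
  intro hR ω₂ lam β γ hω hl hβ hγ T hT c hc
  refine ⟨0, 2, fun N hN => ?_⟩
  have ht : (0 : ℝ) ≤ c * (N : ℝ) ^ 2 := by positivity
  rw [zero_mul, neg_zero, ← integral_transient_eq hω hl hβ hγ hT N ht]
  refine intervalIntegral.integral_nonneg ht fun s hs => ?_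
  rw [oneSub_stepResponse_sub_escapeDeficit_eq_returnTail hω hl hβ hγ hT N hs.1]
  exact mul_nonneg (by positivity) (hR ω₂ lam β γ hω hl hβ hγ T hT N s hN hs.1)

/-- **DOOR v7 on its true hypotheses: `LeakPoint → ReturnTailSign → SurvivalSign → BoundedResponse`** — the door of record
(`boundedResponse_of_leakPoint_boundaryDEP`, g96) with the numerically refuted 13198 replaced by the two `N ≥ 2` tail rungs it
actually consumes: (D_S) ⟸ `SurvivalSign`, (F₁) ⟸ `ReturnTailSign`.  The residual (D_F) `LeakPoint` is VERBATIM unchanged; on the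
window axis door v9 weakens the side hypotheses further to the floors. [new] -/
theorem boundedResponse_of_leakPoint_returnTail_survivalSign :
    LeakPoint → ReturnTailSign → SurvivalSign → BoundedResponse := fun hF hR hS =>
  boundedResponse_of_leakPoint_storageBound_transientFloor hF (storageBound_of_survivalSign hS)
    (transientFloor_of_returnTailSign 1 hR)

/-- **Converse on tail signs: `BoundedResponse → CrossTailSign → SurvivalSign → LeakPoint`** (`F = W − S^{stor} ≤ W`, and
`W_N(cN²) ≤ CN` from 11071 ∧ (U)). [new] -/
theorem leakPoint_of_boundedResponse_crossTail_survivalSign :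
    BoundedResponse → CrossTailSign → SurvivalSign → LeakPoint := by
  intro hB hX hS ω₂ lam β γ hω hl hβ hγ T hT
  obtain ⟨C, c, hc, N₀, hW⟩ := deficitCesaroPoint_of_ohmicFloor_transientCeiling (ohmicFloor_iff_boundedResponse.mpr hB)
    (transientCeilingPoint_of_crossTail_survivalSign hX hS) ω₂ lam β γ hω hl hβ hγ T hT
  refine ⟨C, c, hc, max N₀ 2, fun N hN => ?_⟩
  have hN2 : 2 ≤ N := le_of_max_le_right hN
  have ht : 0 ≤ c * (N : ℝ) ^ 2 := by positivity
  have hS0 := storageResponse_nonneg_of_survival_nonneg hω hl hβ hγ hN2 hT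
    (fun s hs => hS ω₂ lam β γ hω hl hβ hγ T hT N s hN2 hs) ht
  have hid := deficitCesaro_eq_storage_add_leak hω hl hβ hγ hN2 hT ht
  linarith [hW N (le_of_max_le_left hN)]

/-- **`LeakPoint ↔ BoundedResponse` modulo `TailDEP`** (door v7's equivalence on the tail form of the sign crux). [new] -/
theorem leakPoint_iff_boundedResponse_of_tailDEP (h : TailDEP) : LeakPoint ↔ BoundedResponse :=
  ⟨fun hF => boundedResponse_of_leakPoint_returnTail_survivalSign hF h.1 (survivalSign_of_tailDEP h),
    fun hB => leakPoint_of_boundedResponse_crossTail_survivalSign hB h.2 (survivalSign_of_tailDEP h)⟩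

/-- **`DeficitCesaroPoint ↔ BoundedResponse` modulo `TailDEP`.** [new] -/
theorem deficitCesaroPoint_iff_boundedResponse_of_tailDEP (h : TailDEP) : DeficitCesaroPoint ↔ BoundedResponse :=
  ⟨fun hD => boundedResponse_of_deficitCesaroPoint_transientFloor hD (transientFloor_of_returnTailSign 1 h.1),
    fun hB => deficitCesaroPoint_of_ohmicFloor_transientCeiling (ohmicFloor_iff_boundedResponse.mpr hB)
      (transientCeilingPoint_of_crossTail_survivalSign h.2 (survivalSign_of_tailDEP h))⟩

/-- Under `TailDEP` all three readings of 11071 — (D_F) `LeakPoint`, (TW) `TransmissionWindowBound`, (D) `DeficitCesaroPoint` —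
coincide. [new] -/
theorem leakPoint_iff_transmissionWindowBound_of_tailDEP (h : TailDEP) : LeakPoint ↔ TransmissionWindowBound :=
  (leakPoint_iff_boundedResponse_of_tailDEP h).trans (transmissionWindowBound_iff_boundedResponse_of_tailDEP h).symm

/-- **DOOR v8, cooling form: `LeakPoint → ReturnTailSign → CoolingSign → BoundedResponse`** — the survival sign supplied by
the one-covariance hypothesis. [new] -/
theorem boundedResponse_of_leakPoint_returnTail_coolingSign :
    LeakPoint → ReturnTailSign → CoolingSign → BoundedResponse := fun hF hR hg =>
  boundedResponse_of_leakPoint_returnTail_survivalSign hF hR (survivalSign_of_coolingSign hg)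

end TailSign

end Summit.AtomisticToContinuum.FouriersLaw.Theorems.BoundedResponse.ParityFloor

end
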